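import Literature.NumberTheory.Sieve.AsymptoticSieveForPrimesS2Rough
import Literature.NumberTheory.Sieve.AsymptoticSieveForPrimesRoughAssembly
import Literature.NumberTheory.Sieve.FriedlanderIwaniecPrimesRough
import HarnessLib

/-!
# Friedlander–Iwaniec's asymptotic sieve for primes with the sieved bilinear hypothesis (B*): Theorem 1 under (B*), discharged; parity.S17 from Propositions 3.5 and 4.1

Topic `Literature/NumberTheory/Sieve` (trunk T-SIEVE), the closing file of the programme of
`Literature.NumberTheory.Sieve.AsymptoticSieveForPrimesRough`. Sources: J. Friedlander, H. Iwaniec,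
*Asymptotic sieve for primes*, Ann. of Math. 148 (1998) 1041–1065 [FriedlanderIwaniecASP1998], §10
Theorem 3; *The polynomial `X² + Y⁴` captures its primes*, ibid. 945–1040
[FriedlanderIwaniecAnnals1998], §2 Proposition 2.1, §4 (4.7)–(4.8), Theorem 1.

* `fi_asymptotic_sieve_primes_rough_loglog_holds` — **the named fact
  `fi_asymptotic_sieve_primes_rough_loglog` (FI's Theorem 1 with (B) replaced by (B*), the statement
  FI establish in §10 in proving Theorem 3; the case of [FriedlanderIwaniecAnnals1998] Proposition 2.1
  that the tree applies to `μ²(n) #{(a,c) : a² + c⁴ = n}`) is now a THEOREM**: the assembly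
  `fi_asymptotic_sieve_primes_rough_loglog_of_rough_estimates` (`…RoughAssembly`, with the (B)-free
  estimates (4.5), (5.1), (6.6) of `…CoreEstimates`) fed with `fi_asp_S2_estimate_rough_holds`
  (`…S2Rough`, (7.2) under (B*)) and `fi_asp_S3_estimate_rough_holds` (`…S3Rough`, (8.5) under (B*)).
* Consequences for parity.S17 through the sibling bridge `…FriedlanderIwaniecPrimesRough`
  (`setOf_prime_sq_add_pow_four_infinite_of_rough_inputs` etc.): Friedlander–Iwaniec's Theorem 1
  (`friedlanderIwaniecSum_isEquivalent`), its (4.7)-form and its qualitative clause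
  (`setOf_prime_sq_add_pow_four_infinite`: infinitely many primes `a² + b⁴`) follow from exactly TWO
  deep named facts of [FriedlanderIwaniecAnnals1998] — Proposition 3.5 (level of distribution
  `x^{3/4-ε}`, §3; or FI Lemma 3.1 through `FriedlanderIwaniec1998_prop35_of_lemma31`) and
  Proposition 4.1 (the bilinear form bound, §§4–26) — every other printed input (Prop. 2.1 = ASP
  Theorems 1–3 in the form consumed, (2.2), (2.7), (2.8) in the form that holds, (4.2), (4.8), the
  deduction of (1.1)) being a theorem of the tree: `…_of_prop35_of_prop41`, `…_of_lemma31_of_prop41`.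

## References

* J. Friedlander, H. Iwaniec, *Asymptotic sieve for primes*, Ann. of Math. 148 (1998), 1041–1065,
  §10 Theorem 3. [cite: FriedlanderIwaniecASP1998, §10 Theorem 3]
* J. Friedlander, H. Iwaniec, *The polynomial `X² + Y⁴` captures its primes*, Ann. of Math. 148
  (1998), 945–1040, Theorem 1, Proposition 2.1, (4.7)–(4.8). [cite: FriedlanderIwaniecAnnals1998, Theorem 1]

## Mathlib / tree search

Compositions of theorems of the tree (`lean search 'rough_loglog_holds|of_prop35_of_prop41'`: no
declaration before this file).
-/

noncomputable section

namespace Literature.NumberTheory.Sieve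

/-- **Friedlander–Iwaniec, asymptotic sieve for primes: Theorem 1 with the bilinear hypothesis (B)
replaced by the sieved form (B*), DISCHARGED** (regime `δ = (log x)^α`, `Δ = x^θ`, `0 < θ < 1/3`; the
statement FI prove in §10, pp. 1063–1065, for Theorem 3). One line from the tree.
[cite: FriedlanderIwaniecASP1998, §10 Theorem 3 (proof) and Theorem 1 (1.17), p. 1044] -/
theorem fi_asymptotic_sieve_primes_rough_loglog_holds : fi_asymptotic_sieve_primes_rough_loglog :=
  fi_asymptotic_sieve_primes_rough_loglog_of_rough_estimates fi_asp_S2_estimate_rough_holds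
    fi_asp_S3_estimate_rough_holds

/-- **FI (4.7)–(4.8) from Propositions 3.5 and 4.1**: `S(x) = (4/π) A(x)(1 + O(log log x/log x))` for
`a_n = #{(a,c) : a² + c⁴ = n}` follows from FI Proposition 3.5 and Proposition 4.1 alone.
[cite: FriedlanderIwaniecAnnals1998, §4, (4.7)-(4.8)] -/
theorem FriedlanderIwaniec1998_primeSum_asymp_of_prop35_of_prop41 (h35 : FriedlanderIwaniec1998_prop35)
    (h41 : FriedlanderIwaniec1998_prop41) : FriedlanderIwaniec1998_primeSum_asymp :=
  FriedlanderIwaniec1998_primeSum_asymp_of_rough_inputs fi_asymptotic_sieve_primes_rough_loglog_holds h35 h41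

/-- **Friedlander–Iwaniec Theorem 1 (parity.S17, quantitative form) from Propositions 3.5 and 4.1.**
[cite: FriedlanderIwaniecAnnals1998, Theorem 1] -/
theorem friedlanderIwaniecSum_isEquivalent_of_prop35_of_prop41 (h35 : FriedlanderIwaniec1998_prop35)
    (h41 : FriedlanderIwaniec1998_prop41) : friedlanderIwaniecSum_isEquivalent :=
  friedlanderIwaniecSum_isEquivalent_of_rough_inputs fi_asymptotic_sieve_primes_rough_loglog_holds h35 h41

/-- **parity.S17, qualitative clause — infinitely many primes `p = a² + b⁴` — from Propositions 3.5
and 4.1 of [FriedlanderIwaniecAnnals1998]** (the level of distribution `x^{3/4-ε}` and the bilinear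
form bound of §§4–26); the discharge `setOf_prime_sq_add_pow_four_infinite_holds` is this theorem
applied to their future proofs. [cite: FriedlanderIwaniecAnnals1998, Theorem 1] -/
theorem setOf_prime_sq_add_pow_four_infinite_of_prop35_of_prop41 (h35 : FriedlanderIwaniec1998_prop35)
    (h41 : FriedlanderIwaniec1998_prop41) : setOf_prime_sq_add_pow_four_infinite :=
  setOf_prime_sq_add_pow_four_infinite_of_rough_inputs fi_asymptotic_sieve_primes_rough_loglog_holds h35 h41

/-- **FI (4.7)–(4.8) from FI Lemma 3.1 and Proposition 4.1** (Proposition 3.5 being reduced to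
Lemma 3.1 in the tree, `FriedlanderIwaniec1998_prop35_of_lemma31`).
[cite: FriedlanderIwaniecAnnals1998, §4, (4.7)-(4.8)] -/
theorem FriedlanderIwaniec1998_primeSum_asymp_of_lemma31_of_prop41 (h31 : FriedlanderIwaniec1998_lemma31)
    (h41 : FriedlanderIwaniec1998_prop41) : FriedlanderIwaniec1998_primeSum_asymp :=
  FriedlanderIwaniec1998_primeSum_asymp_of_rough_lemma31_inputs fi_asymptotic_sieve_primes_rough_loglog_holds
    h31 h41

/-- **Friedlander–Iwaniec Theorem 1 (parity.S17) from FI Lemma 3.1 and Proposition 4.1.**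
[cite: FriedlanderIwaniecAnnals1998, Theorem 1] -/
theorem friedlanderIwaniecSum_isEquivalent_of_lemma31_of_prop41 (h31 : FriedlanderIwaniec1998_lemma31)
    (h41 : FriedlanderIwaniec1998_prop41) : friedlanderIwaniecSum_isEquivalent :=
  friedlanderIwaniecSum_isEquivalent_of_rough_lemma31_inputs fi_asymptotic_sieve_primes_rough_loglog_holds
    h31 h41

/-- **Infinitely many primes `a² + b⁴` from FI Lemma 3.1 and Proposition 4.1.**
[cite: FriedlanderIwaniecAnnals1998, Theorem 1] -/
theorem setOf_prime_sq_add_pow_four_infinite_of_lemma31_of_prop41 (h31 : FriedlanderIwaniec1998_lemma31)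
    (h41 : FriedlanderIwaniec1998_prop41) : setOf_prime_sq_add_pow_four_infinite :=
  setOf_prime_sq_add_pow_four_infinite_of_rough_lemma31_inputs fi_asymptotic_sieve_primes_rough_loglog_holds
    h31 h41

end Literature.NumberTheory.Sieve
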